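import Summits.QuantumFields.YangMills.Theorems.AllWindowsColdBoxBoxHighLineStep2Wick
import Summits.QuantumFields.YangMills.Theorems.AllWindowsColdBoxBoxHighLineSmallFieldInsideFPCore
import Summits.QuantumFields.YangMills.Theorems.AllWindowsColdBoxBoxHighLineVarianceBounded

/-!
# T-S5.6g `GaussianSmallFieldTail` BY NAME — the Hodge Gaussian of the chart rarely leaves the small-field box
# (STUB-PLAN-S5-STEP2 §5/§8, task Prop of ✓`…Step2Wick`; planner ym-idea-2 g18 routing 19:54:19Z / 20:00:40Z «6g by name from ✓ChartGaussianTail»;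
# LINE-19 S5 ⟨stmt-QuantumFields-24004⟩/⟨24335⟩, LINE-20 U5 ⟨24336⟩)

Width seat `ym-line-sfw-p2-w4` (prover-ym-line-sfw-p2-w4-g28-0).  The task Prop

  `GaussianSmallFieldTail : ∃ C c, 0 < c ∧ ∀ H ≥ 1, ∀ β s > 0, E₀[1 − 1_{smallField H s}] ≤ C·H⁴·e^{−cβs²}`

(`E₀ = gaussAvg β H`, the normalised Gaussian `e^{−β·boxQuadForm H a} da` on ALL edge fields) is the quotient form of w4 g27's relative tail
✓`ChartGauss.setIntegral_compl_smallField_exp_le` (`∫_{a ∉ smallField H s} e^{−βQ} ≤ 6·|LandauFree H|·e^{−βs²/(3C₃)}·∫ e^{−βQ}` given the variance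
bound `(hodgeQ H)⁻¹ₑₑ ≤ C₃`), fed with ✓S3a `landauVarianceBounded` (the variance bound, uniformly in `H ≥ 1`) and ✓`SmallFieldFP.card_landauFree_le`
(`|LandauFree H| ≤ 216·H⁴`).  Constants: `C = 6·216 = 1296`, `c = 1/(3·max(C₃,1))`.

* `GaussTail.one_sub_sfInd_mul_gaussWeight` — the integrand `(1 − sfInd)(a)·gaussWeight(a)` is the indicator of `(smallField H s)ᶜ` times the weight;
* `GaussTail.gaussAvg_one_sub_sfInd_eq` — `E₀[1 − 1_{smallField s}] = ∫_{(smallField s)ᶜ} e^{−βQ} / ∫ e^{−βQ}`;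
* `GaussTail.gaussAvg_one_sub_sfInd_le` — the bound with an explicit variance constant `C₃`: `≤ 6·|LandauFree H|·e^{−βs²/(3C₃)}`;
* **`gaussianSmallFieldTail : GaussianSmallFieldTail`** (T-S5.6g by name).

Everything proved; no definitions; standard axioms.  HONEST LABEL: an S-brick of STEP 2 of the XL stub S5 (`stub_landauSecondOrder`) of a critic-PASSed
DRAFT line; S5, U5 and the items ⟨24004⟩ ⟨24335⟩ ⟨24336⟩ remain OPEN; no crux, rung or summit is proved; the Yang–Mills mass gap is NOT proved by this file.
-/

set_option autoImplicit false

open MeasureTheory Real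

namespace Summit.QuantumFields.YangMills.Theorems.AllWindowsColdBoxBoxHighLine

namespace GaussTail

variable {H : ℕ}

/-- The integrand of `E₀[1 − 1_{smallField s}]`: `(1 − sfInd H s a)·gaussWeight β H a = 1_{(smallField H s)ᶜ}(a)·gaussWeight β H a`. -/
theorem one_sub_sfInd_mul_gaussWeight (β s : ℝ) (a : LandauFree H → E3) :
    (1 - sfInd H s a) * gaussWeight β H a = (smallField H s)ᶜ.indicator (gaussWeight β H) a := by
  by_cases ha : a ∈ smallField H s
  · rw [sfInd, Set.indicator_of_mem ha, Set.indicator_of_notMem (Set.notMem_compl_iff.2 ha), sub_self, zero_mul]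
  · rw [sfInd, Set.indicator_of_notMem ha, Set.indicator_of_mem (Set.mem_compl ha), sub_zero, one_mul]

/-- **`E₀[1 − 1_{smallField s}] = (∫_{(smallField H s)ᶜ} e^{−β·boxQuadForm}) / ∫ e^{−β·boxQuadForm}`.** -/
theorem gaussAvg_one_sub_sfInd_eq (β : ℝ) (H : ℕ) (s : ℝ) :
    gaussAvg β H (fun a => 1 - sfInd H s a) =
      (∫ a in (smallField H s)ᶜ, Real.exp (-(β * boxQuadForm H a))) /
        ∫ a : LandauFree H → E3, Real.exp (-(β * boxQuadForm H a)) := by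
  have h1 : (fun a : LandauFree H → E3 => (1 - sfInd H s a) * gaussWeight β H a) =
      (smallField H s)ᶜ.indicator (gaussWeight β H) := funext (one_sub_sfInd_mul_gaussWeight β s)
  rw [gaussAvg, h1, integral_indicator (ChartGauss.measurableSet_smallField s).compl]
  rfl

/-- **The tail bound with an explicit variance constant.**  For `β > 0`, `s ≥ 0` and `(hodgeQ H)⁻¹ₑₑ ≤ C₃` (`C₃ > 0`):
`E₀[1 − 1_{smallField H s}] ≤ 6·|LandauFree H|·e^{−βs²/(3C₃)}` (quotient form of ✓`ChartGauss.setIntegral_compl_smallField_exp_le`). -/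
theorem gaussAvg_one_sub_sfInd_le {β s C₃ : ℝ} (hβ : 0 < β) (hs : 0 ≤ s) (hC₃ : 0 < C₃)
    (hvar : ∀ e : LandauFree H, (hodgeQ H)⁻¹ e e ≤ C₃) :
    gaussAvg β H (fun a => 1 - sfInd H s a) ≤
      6 * Fintype.card (LandauFree H) * Real.exp (-(β * s ^ 2 / (3 * C₃))) := by
  rw [gaussAvg_one_sub_sfInd_eq, div_le_iff₀ (ChartGauss.integral_exp_neg_mul_boxQuadForm_pos hβ)]
  exact ChartGauss.setIntegral_compl_smallField_exp_le hβ hs hC₃ hvar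

end GaussTail

/-- **T-S5.6g `GaussianSmallFieldTail`** (task Prop of ✓`…Step2Wick`, BY NAME): under the Hodge Gaussian of the chart the complement of the small-field
box is exponentially rare, `E₀[1 − 1_{smallField H s}] ≤ 1296·H⁴·exp(−βs²/(3·max(C₃,1)))` for all `H ≥ 1`, `β > 0`, `s > 0`, where `C₃` is the
variance constant of ✓S3a `landauVarianceBounded` (`(hodgeQ H)⁻¹ₑₑ ≤ C₃`); union over the `3·|LandauFree H| ≤ 648·H⁴` flat coordinates of
single-coordinate Gaussian tails (✓`ChartGauss.setIntegral_compl_smallField_exp_le`, ✓`SmallFieldFP.card_landauFree_le`). -/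
theorem gaussianSmallFieldTail : GaussianSmallFieldTail := by
  obtain ⟨C, hC⟩ := landauVarianceBounded
  have hC₃ : 0 < max C 1 := lt_of_lt_of_le one_pos (le_max_right _ _)
  refine ⟨1296, 1 / (3 * max C 1), by positivity, fun H hH β s hβ hs => ?_⟩
  have hvar : ∀ e : LandauFree H, (hodgeQ H)⁻¹ e e ≤ max C 1 := fun e => (hC H hH e).trans (le_max_left _ _)
  have h1 := GaussTail.gaussAvg_one_sub_sfInd_le (H := H) hβ hs.le hC₃ hvar
  have hcard := SmallFieldFP.card_landauFree_le (H := H) hH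
  have hexp : Real.exp (-(β * s ^ 2 / (3 * max C 1))) = Real.exp (-(1 / (3 * max C 1) * β * s ^ 2)) := by
    congr 1; ring
  rw [hexp] at h1
  refine h1.trans ?_
  have hE : 0 ≤ Real.exp (-(1 / (3 * max C 1) * β * s ^ 2)) := (Real.exp_pos _).le
  nlinarith [mul_le_mul_of_nonneg_right hcard hE]

end Summit.QuantumFields.YangMills.Theorems.AllWindowsColdBoxBoxHighLine
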